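import Summits.CriticalPhenomena.PercolationContinuityZ3.Theorems.Transplant.FKConnectivityAllQPat3ShapeZeroK
import Summits.CriticalPhenomena.PercolationContinuityZ3.Theorems.Transplant.FKConnectivityAllQPat3EeeKPathMidFreeTsymB6
import Summits.CriticalPhenomena.PercolationContinuityZ3.Theorems.Transplant.FKConnectivityAllQPat3EeeKPathMidFreeStarXB6
import Summits.CriticalPhenomena.PercolationContinuityZ3.Theorems.Transplant.FKConnectivityAllQPat3EeeKPathMidFreeStarXmB6
import Summits.CriticalPhenomena.PercolationContinuityZ3.Theorems.Transplant.FKConnectivityAllQPat3EeeKPathMidFreeStarSB6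
import Summits.CriticalPhenomena.PercolationContinuityZ3.Theorems.Transplant.FKConnectivityAllQPat3EeeKPathMidBdTsymB
import Summits.CriticalPhenomena.PercolationContinuityZ3.Theorems.Transplant.FKConnectivityAllQPat3EeeKPathMidBdStarXB
import Summits.CriticalPhenomena.PercolationContinuityZ3.Theorems.Transplant.FKConnectivityAllQPat3EeeKPathMidBdStarXmB
import Summits.CriticalPhenomena.PercolationContinuityZ3.Theorems.Transplant.FKConnectivityAllQPat3EeeKPathMidBdStarSB
import Summits.CriticalPhenomena.PercolationContinuityZ3.Theorems.Transplant.FKConnectivityAllQPat3EeeKPathMidAdTsymB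
import Summits.CriticalPhenomena.PercolationContinuityZ3.Theorems.Transplant.FKConnectivityAllQPat3EeeKPathMidAdStarXB
import Summits.CriticalPhenomena.PercolationContinuityZ3.Theorems.Transplant.FKConnectivityAllQPat3EeeKPathMidAdStarXmB
import Summits.CriticalPhenomena.PercolationContinuityZ3.Theorems.Transplant.FKConnectivityAllQPat3EeeKPathMidAdStarSB
import Summits.CriticalPhenomena.PercolationContinuityZ3.Theorems.Transplant.FKConnectivityAllQPat3EeeKPathMidAdbdTsymB
import Summits.CriticalPhenomena.PercolationContinuityZ3.Theorems.Transplant.FKConnectivityAllQPat3EeeKPathMidAdbdStarXB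
import Summits.CriticalPhenomena.PercolationContinuityZ3.Theorems.Transplant.FKConnectivityAllQPat3EeeKPathMidAdbdStarXmB
import Summits.CriticalPhenomena.PercolationContinuityZ3.Theorems.Transplant.FKConnectivityAllQPat3EeeKPathMidAdbdStarSB
import Summits.CriticalPhenomena.PercolationContinuityZ3.Theorems.Transplant.FKConnectivityAllQPat3EeeKPathMidAcTsymB
import Summits.CriticalPhenomena.PercolationContinuityZ3.Theorems.Transplant.FKConnectivityAllQPat3EeeKPathMidAcStarXB
import Summits.CriticalPhenomena.PercolationContinuityZ3.Theorems.Transplant.FKConnectivityAllQPat3EeeKPathMidAcStarXmB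
import Summits.CriticalPhenomena.PercolationContinuityZ3.Theorems.Transplant.FKConnectivityAllQPat3EeeKPathMidAcStarSB
import Summits.CriticalPhenomena.PercolationContinuityZ3.Theorems.Transplant.FKConnectivityAllQPat3EeeKPathMidAcbdTsymB
import Summits.CriticalPhenomena.PercolationContinuityZ3.Theorems.Transplant.FKConnectivityAllQPat3EeeKPathMidAcbdStarXB
import Summits.CriticalPhenomena.PercolationContinuityZ3.Theorems.Transplant.FKConnectivityAllQPat3EeeKPathMidAcbdStarXmB
import Summits.CriticalPhenomena.PercolationContinuityZ3.Theorems.Transplant.FKConnectivityAllQPat3EeeKPathMidAcbdStarSB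
import Summits.CriticalPhenomena.PercolationContinuityZ3.Theorems.Transplant.FKConnectivityAllQPat3EeeKPathMidAcadTsymB
import Summits.CriticalPhenomena.PercolationContinuityZ3.Theorems.Transplant.FKConnectivityAllQPat3EeeKPathMidAcadStarXB
import Summits.CriticalPhenomena.PercolationContinuityZ3.Theorems.Transplant.FKConnectivityAllQPat3EeeKPathMidAcadStarXmB
import Summits.CriticalPhenomena.PercolationContinuityZ3.Theorems.Transplant.FKConnectivityAllQPat3EeeKPathMidAcadStarSB
import Summits.CriticalPhenomena.PercolationContinuityZ3.Theorems.Transplant.FKConnectivityAllQPat3EeeKPathMidAcadbdTsymB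
import Summits.CriticalPhenomena.PercolationContinuityZ3.Theorems.Transplant.FKConnectivityAllQPat3EeeKPathMidAcadbdStarXB
import Summits.CriticalPhenomena.PercolationContinuityZ3.Theorems.Transplant.FKConnectivityAllQPat3EeeKPathMidAcadbdStarXmB
import Summits.CriticalPhenomena.PercolationContinuityZ3.Theorems.Transplant.FKConnectivityAllQPat3EeeKPathMidAcadbdStarSB
import HarnessLib

/-!
# Connectivity correlation inequalities for `φ_{w,q}`, every `q > 0` — THE LEAF EEEpath_mid IN ALL EIGHT K-STATES: the row facts bundled over
# the splits of `[(0, 2), (0, 3), (1, 3)]` (census g41)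

Proof file (`--supports stmt-CriticalPhenomena-4575`), census lineage (gen 41) of LANE 2's FK sub-programme; builds on p205010 (kernel
theorem, internal audit signed; external expert review pending).  No definitions, no named facts, no sorries; standard axioms.

Collects the closing `_rows` theorems of the 32 data file groups `…Pat3EeeKPathMid<State><Target>…` (8 states × 4 targets; census g41's prepared
set, kit j242142 certificates, `coefTab3K`) into four statements quantified over the state (L, K) of the three plain slots:
`FK.eeeKpathmid_tsym_rows / _starX_rows / _starXm_rows / _starS_rows` — the form the K-state leaf lemmas `…Pat3EeeLeafK` consume.
[cite: AyyerLinussonRavichandran2025, §7 (p. 22)]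
-/

namespace Summit.CriticalPhenomena.PercolationContinuityZ3.Theorems

namespace FK

/-- The 8 ordered splits of the plain slots `[(0, 2), (0, 3), (1, 3)]` into (free, contracted), in the order `FK.splits` lists them. [folklore] -/
theorem splits_eeepathmidSkelK : splits ([(0, 2), (0, 3), (1, 3)] : List (Fin 7 × Fin 7)) =
    [([(0, 2), (0, 3), (1, 3)], []),
     ([(0, 2), (0, 3)], [(1, 3)]),
     ([(0, 2), (1, 3)], [(0, 3)]),
     ([(0, 2)], [(0, 3), (1, 3)]),
     ([(0, 3), (1, 3)], [(0, 2)]),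
     ([(0, 3)], [(0, 2), (1, 3)]),
     ([(1, 3)], [(0, 2), (0, 3)]),
     ([], [(0, 2), (0, 3), (1, 3)])] := by
  decide

/-- **EEEpath_mid rows in every K-state, target `tsym2Tab`** (kernel-checked certificates of the 8 data file groups). [cite: AyyerLinussonRavichandran2025, §7 (p. 22)] -/
theorem eeeKpathmid_tsym_rows : ∀ LK ∈ splits ([(0, 2), (0, 3), (1, 3)] : List (Fin 7 × Fin 7)), ∃ prods : List Prod3, ∃ Dn : ℕ, 0 < Dn ∧
    (∃ cs : List (ℕ × ℕ × ℕ × ℕ × ℕ), prods = cs.map (Prod3.ofIdx famP11orb)) ∧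
    ∀ (d : ℕ) (PK QK P1 Q1 P2 Q2 : Pat3), 8 * (prods.map fun q => (q.lam : ℤ) * q.tensor d PK QK P1 Q1 P2 Q2).sum ≤
      (Dn : ℤ) * symm8d (coefTab3K LK.1 LK.2 (0 : Fin 7) 1 4 1 2 5 2 3 6 5 4 6 tsym2Tab) d PK QK P1 Q1 P2 Q2 := by
  intro LK hLK
  rw [splits_eeepathmidSkelK] at hLK
  fin_cases hLK

  · exact ⟨eeeKpathmidfree_tsymProds, 191926788294406704682347520, by decide, ⟨_, rfl⟩, eeeKpathmidfree_tsym_rows⟩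
  · exact ⟨eeeKpathmidbd_tsymProds, 1852800, by decide, ⟨_, rfl⟩, eeeKpathmidbd_tsym_rows⟩
  · exact ⟨eeeKpathmidad_tsymProds, 92306388096, by decide, ⟨_, rfl⟩, eeeKpathmidad_tsym_rows⟩
  · exact ⟨eeeKpathmidadbd_tsymProds, 8, by decide, ⟨_, rfl⟩, eeeKpathmidadbd_tsym_rows⟩
  · exact ⟨eeeKpathmidac_tsymProds, 1852800, by decide, ⟨_, rfl⟩, eeeKpathmidac_tsym_rows⟩
  · exact ⟨eeeKpathmidacbd_tsymProds, 16, by decide, ⟨_, rfl⟩, eeeKpathmidacbd_tsym_rows⟩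
  · exact ⟨eeeKpathmidacad_tsymProds, 8, by decide, ⟨_, rfl⟩, eeeKpathmidacad_tsym_rows⟩
  · exact ⟨eeeKpathmidacadbd_tsymProds, 1, by decide, ⟨_, rfl⟩, eeeKpathmidacadbd_tsym_rows⟩

/-- **EEEpath_mid rows in every K-state, target `starXTab`** (kernel-checked certificates of the 8 data file groups). [cite: AyyerLinussonRavichandran2025, §7 (p. 22)] -/
theorem eeeKpathmid_starX_rows : ∀ LK ∈ splits ([(0, 2), (0, 3), (1, 3)] : List (Fin 7 × Fin 7)), ∃ prods : List Prod3, ∃ Dn : ℕ, 0 < Dn ∧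
    (∃ cs : List (ℕ × ℕ × ℕ × ℕ × ℕ), prods = cs.map (Prod3.ofIdx famP11orb)) ∧
    ∀ (d : ℕ) (PK QK P1 Q1 P2 Q2 : Pat3), 8 * (prods.map fun q => (q.lam : ℤ) * q.tensor d PK QK P1 Q1 P2 Q2).sum ≤
      (Dn : ℤ) * symm8d (coefTab3K LK.1 LK.2 (0 : Fin 7) 1 4 1 2 5 2 3 6 5 4 6 starXTab) d PK QK P1 Q1 P2 Q2 := by
  intro LK hLK
  rw [splits_eeepathmidSkelK] at hLK
  fin_cases hLK

  · exact ⟨eeeKpathmidfree_starXProds, 224434024522074246336000, by decide, ⟨_, rfl⟩, eeeKpathmidfree_starX_rows⟩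
  · exact ⟨eeeKpathmidbd_starXProds, 34329745280, by decide, ⟨_, rfl⟩, eeeKpathmidbd_starX_rows⟩
  · exact ⟨eeeKpathmidad_starXProds, 6759612121200, by decide, ⟨_, rfl⟩, eeeKpathmidad_starX_rows⟩
  · exact ⟨eeeKpathmidadbd_starXProds, 8, by decide, ⟨_, rfl⟩, eeeKpathmidadbd_starX_rows⟩
  · exact ⟨eeeKpathmidac_starXProds, 34329745280, by decide, ⟨_, rfl⟩, eeeKpathmidac_starX_rows⟩
  · exact ⟨eeeKpathmidacbd_starXProds, 16, by decide, ⟨_, rfl⟩, eeeKpathmidacbd_starX_rows⟩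
  · exact ⟨eeeKpathmidacad_starXProds, 8, by decide, ⟨_, rfl⟩, eeeKpathmidacad_starX_rows⟩
  · exact ⟨eeeKpathmidacadbd_starXProds, 1, by decide, ⟨_, rfl⟩, eeeKpathmidacadbd_starX_rows⟩

/-- **EEEpath_mid rows in every K-state, target `mirror2 starXTab`** (kernel-checked certificates of the 8 data file groups). [cite: AyyerLinussonRavichandran2025, §7 (p. 22)] -/
theorem eeeKpathmid_starXm_rows : ∀ LK ∈ splits ([(0, 2), (0, 3), (1, 3)] : List (Fin 7 × Fin 7)), ∃ prods : List Prod3, ∃ Dn : ℕ, 0 < Dn ∧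
    (∃ cs : List (ℕ × ℕ × ℕ × ℕ × ℕ), prods = cs.map (Prod3.ofIdx famP11orb)) ∧
    ∀ (d : ℕ) (PK QK P1 Q1 P2 Q2 : Pat3), 8 * (prods.map fun q => (q.lam : ℤ) * q.tensor d PK QK P1 Q1 P2 Q2).sum ≤
      (Dn : ℤ) * symm8d (coefTab3K LK.1 LK.2 (0 : Fin 7) 1 4 1 2 5 2 3 6 5 4 6 (mirror2 starXTab)) d PK QK P1 Q1 P2 Q2 := by
  intro LK hLK
  rw [splits_eeepathmidSkelK] at hLK
  fin_cases hLK

  · exact ⟨eeeKpathmidfree_starXmProds, 241333664602363656231105043128832, by decide, ⟨_, rfl⟩, eeeKpathmidfree_starXm_rows⟩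
  · exact ⟨eeeKpathmidbd_starXmProds, 192, by decide, ⟨_, rfl⟩, eeeKpathmidbd_starXm_rows⟩
  · exact ⟨eeeKpathmidad_starXmProds, 640008765984, by decide, ⟨_, rfl⟩, eeeKpathmidad_starXm_rows⟩
  · exact ⟨eeeKpathmidadbd_starXmProds, 8, by decide, ⟨_, rfl⟩, eeeKpathmidadbd_starXm_rows⟩
  · exact ⟨eeeKpathmidac_starXmProds, 34329745280, by decide, ⟨_, rfl⟩, eeeKpathmidac_starXm_rows⟩
  · exact ⟨eeeKpathmidacbd_starXmProds, 16, by decide, ⟨_, rfl⟩, eeeKpathmidacbd_starXm_rows⟩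
  · exact ⟨eeeKpathmidacad_starXmProds, 8, by decide, ⟨_, rfl⟩, eeeKpathmidacad_starXm_rows⟩
  · exact ⟨eeeKpathmidacadbd_starXmProds, 1, by decide, ⟨_, rfl⟩, eeeKpathmidacadbd_starXm_rows⟩

/-- **EEEpath_mid rows in every K-state, target `starSTab`** (kernel-checked certificates of the 8 data file groups). [cite: AyyerLinussonRavichandran2025, §7 (p. 22)] -/
theorem eeeKpathmid_starS_rows : ∀ LK ∈ splits ([(0, 2), (0, 3), (1, 3)] : List (Fin 7 × Fin 7)), ∃ prods : List Prod3, ∃ Dn : ℕ, 0 < Dn ∧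
    (∃ cs : List (ℕ × ℕ × ℕ × ℕ × ℕ), prods = cs.map (Prod3.ofIdx famP11orb)) ∧
    ∀ (d : ℕ) (PK QK P1 Q1 P2 Q2 : Pat3), 8 * (prods.map fun q => (q.lam : ℤ) * q.tensor d PK QK P1 Q1 P2 Q2).sum ≤
      (Dn : ℤ) * symm8d (coefTab3K LK.1 LK.2 (0 : Fin 7) 1 4 1 2 5 2 3 6 5 4 6 starSTab) d PK QK P1 Q1 P2 Q2 := by
  intro LK hLK
  rw [splits_eeepathmidSkelK] at hLK
  fin_cases hLK

  · exact ⟨eeeKpathmidfree_starSProds, 241333664602363656231105043128832, by decide, ⟨_, rfl⟩, eeeKpathmidfree_starS_rows⟩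
  · exact ⟨eeeKpathmidbd_starSProds, 34329745280, by decide, ⟨_, rfl⟩, eeeKpathmidbd_starS_rows⟩
  · exact ⟨eeeKpathmidad_starSProds, 640008765984, by decide, ⟨_, rfl⟩, eeeKpathmidad_starS_rows⟩
  · exact ⟨eeeKpathmidadbd_starSProds, 8, by decide, ⟨_, rfl⟩, eeeKpathmidadbd_starS_rows⟩
  · exact ⟨eeeKpathmidac_starSProds, 192, by decide, ⟨_, rfl⟩, eeeKpathmidac_starS_rows⟩
  · exact ⟨eeeKpathmidacbd_starSProds, 16, by decide, ⟨_, rfl⟩, eeeKpathmidacbd_starS_rows⟩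
  · exact ⟨eeeKpathmidacad_starSProds, 8, by decide, ⟨_, rfl⟩, eeeKpathmidacad_starS_rows⟩
  · exact ⟨eeeKpathmidacadbd_starSProds, 1, by decide, ⟨_, rfl⟩, eeeKpathmidacadbd_starS_rows⟩

end FK

end Summit.CriticalPhenomena.PercolationContinuityZ3.Theorems
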